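import Literature.AlgebraicGeometry.AbelianSchemes.AbelianLiftObstructionClassOneAtlas
import HarnessLib

/-!
# Two lifted atlases of an abelian scheme have EQUAL κ-classes on their common doubly-principal refinement
# ([Oort1971] §2.2: `D(X′; R → R′)` «does not depend on the choices made»; Hartshorne, *Deformation Theory*, proof of Thm. 10.2 (a))

Layer `Literature/AlgebraicGeometry/AbelianSchemes`, namespace `Literature.AlgebraicGeometry.AbelianSchemes.AbelianSchemeOver`.
PROOF FILE, ONE THEOREM (no definition, no instance, no notation, no named fact, no `sorry`).  Cell `hodgecm-mathlib`, P6, count-neutral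
capital on `--supports stmt-HodgeConjecture-24832`; the EXPORT of steps (0)–(3) of ★ (vii-g) `liftObstructionVanishes_of_atlas_classZero`
(`AbelianLiftObstructionClassOneAtlas`, LA1-p02 (g7)) as a standalone comparison, for consumers that compare the classes of TWO data by a
LINEAR relation rather than through `= 0` (the (U-ab) `[-1]`-argument, [Oort1971] p. 279: the class of the atlas transported along the
inversion is compared with the class of the original atlas on a common refinement).

THE PRINT.  [Oort1971, §2.2, pp. 277–279]: the obstruction class is computed on any lifted affine atlas and «does not depend on the choices
made»; [Hartshorne2010, Thm. 10.2 (a), proof, p. 81]: one obstruction `δ₃ ∈ H²(X₀, T⁰_{X₀} ⊗ J)` whatever the cover.  In Čech currency WITHOUT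
passing to the colimit over covers this reads: for two data on principal affine covers `V`, `V′` there is a common doubly-principal refinement
`W` (★ `Morphisms.exists_finite_principal_affine_cover_basicOpen_refinement₂`) on which the two REFINED classes coincide.

* `exists_refinement_cechMH2_mk_refine_eq_of_two_atlases` — for `A` Artin local, `J` principal small (`φ : J ≅ κ(A)`), `X₀` abelian over
  `Spec (A⧸J)` and TWO data of the ★ (D) letters (`AbelianLiftObstructionClass`: lifted atlases on covers `V`, `V′`, ONE closed-fibre layer
  `π` with its (R8) letters on both covers, face readings, closed representing cochains `o`, `o′`; the pin `π = pr₁^♯` is not used): there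
  are `m`, a principal affine cover `W : Fin m → _` of `X₀` refining both
  (`τ`, `τ′`, principal in the old charts) with affine traces on the closed fibre, such that
  `[ρ_{τ′} o′] = [ρ_τ o]` in `Ȟ²(pr₁⁻¹𝒲; 𝒯_{X_κ/κ})` — ★ (vii-e) restriction ×2 (`exists_faceReadings_refine_rep`) + ★ (vii-f) chart-independence on
  `W` (`cechMH2_mk_eq_of_chartChange`), verbatim from ★ (vii-g) §2.

HC_CM is proved only modulo the printed citations until rung 0 closes; nothing here bears on a summit statement.

## References
* [Oort1971] F. Oort, *Finite group schemes, local moduli for abelian varieties, and lifting problems*, Compositio Math. 23 (1971), §2.2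
  (pp. 277–280).
* [Hartshorne2010] R. Hartshorne, *Deformation Theory*, GTM 257, Springer (2010): Thm. 10.2 (a) and its proof (p. 81).
* [GortzWedhorn2023] U. Görtz, T. Wedhorn, *Algebraic Geometry II: Cohomology of Schemes* (2023): Lemma 22.1 (p. 233).
-/

noncomputable section

-- `TopCat.Presheaf`/`TopCat.Sheaf` and Mathlib's `Over` API are stated across semireducible wrappers.
set_option backward.isDefEq.respectTransparency false

open CategoryTheory CategoryTheory.Limits AlgebraicGeometry TopologicalSpace Opposite
open scoped TensorProduct
open Literature.AlgebraicGeometry.Morphisms Literature.AlgebraicGeometry.HodgeTheory Literature.AlgebraicGeometry.Modules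
  Literature.AlgebraicGeometry.Motives
open Literature.AlgebraicGeometry.Deformation.AtlasQuot Literature.AlgebraicGeometry.Deformation.CanonicalLiftQuot
  Literature.AlgebraicGeometry.Deformation.LiftAtlasAssemblyQuot Literature.AlgebraicGeometry.Deformation.LiftableCoverQuot
  Literature.AlgebraicGeometry.Deformation.LiftObstructionCocycleQuot Literature.AlgebraicGeometry.Deformation.ExtensionAutomorphismsQuot
  Literature.AlgebraicGeometry.Deformation.LiftObstructionCechClassQuot Literature.AlgebraicGeometry.Deformation.LiftObstructionClassAtlasQuot
  Literature.AlgebraicGeometry.Deformation.LiftClosedFibreDictionaryQuot Literature.AlgebraicGeometry.Deformation.LiftOfClassZeroAtlasQuot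

namespace Literature.AlgebraicGeometry.AbelianSchemes.AbelianSchemeOver

variable {A : Type} [CommRing A] [IsArtinianRing A] [IsLocalRing A] {J : Ideal A}

set_option maxHeartbeats 400000 in -- two 28-letter data, their restrictions to the common refinement, (vii-e) ×4 + (vii-f): as ★ (vii-g) §2
/-- **Two lifted atlases have equal κ-classes on a common refinement.**  `A` Artin local, `J` principal small (`J ≠ ⊤`, `𝔪·J = 0`,
`φ : J ≅ κ(A)`), `X₀` an abelian scheme over `Spec (A⧸J)`; two data of the ★ (D) letters — lifted atlases `(n, V, c, P, r, ψ)`,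
`(n′, V′, c′, P′, r′, ψ′)` (finite principal affine covers, standard smooth flat charts with `ker = J·P`, reduction-compatible gluings),
ONE closed-fibre layer `π` on the canonical closed fibre `X₀ ×_{A⧸J} κ(A)` with its (R8) letters on both covers (`hπ`, `hπ′`, `hπnat`; e.g.
`π = pr₁^♯`, ★ (vii-c) — the pin `hπi` is not needed here), face readings `δ`, `δ′`, closed Čech 2-cochains `o`, `o′` of `𝒯_{X_κ/κ}` on the
trace covers representing them (`ho`, `ho′` through `φ`).  Then there is a principal affine cover `W : Fin m → _` of `X₀` refining `V` along `τ`
and `V′` along `τ′` (principal in the old charts), with affine traces `pr₁⁻¹W_j`, and `[ρ_{τ′} o′] = [ρ_τ o]` in `Ȟ²(pr₁⁻¹𝒲; 𝒯_{X_κ/κ})`: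
the class «does not depend on the choices made».
[cite: Oort1971, §2.2 (pp. 277–280)] [cite: Hartshorne2010, Thm. 10.2 (a) (proof), p. 81] [cite: GortzWedhorn2023, Lemma 22.1 (p. 233)] -/
theorem exists_refinement_cechMH2_mk_refine_eq_of_two_atlases (hJ : J ≠ ⊤) (hmJ : IsLocalRing.maximalIdeal A * J = ⊥)
    (φ : ↥J ≃ₗ[A] IsLocalRing.ResidueField A) (X₀ : AbelianSchemeOver (Spec (.of (A ⧸ J)))) :
    letI : ∀ W : X₀.X.left.Opens, Algebra A Γ(X₀.X.left, W) := fun W =>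
      (((Scheme.ΓSpecIso (.of (A ⧸ J))).inv ≫ X₀.X.hom.appLE ⊤ W le_top).hom.comp (Ideal.Quotient.mk J)).toAlgebra
    ∀ (n : ℕ) (V : Fin n → X₀.X.left.affineOpens) (c : (a b : Fin n) → Γ(X₀.X.left, (V a).1))
      (P : Fin n → Type) [∀ a, CommRing (P a)] [∀ a, Algebra A (P a)] [∀ a, Algebra.IsStandardSmooth A (P a)]
      [∀ a, Module.Flat A (P a)]
      (r : (a : Fin n) → P a →ₐ[A] Γ(X₀.X.left, (V a).1))
      (ψ : (a b : Fin n) → chartLift V r a (inf_le_left : (V a).1 ⊓ (V b).1 ≤ (V a).1) ≃ₐ[A]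
        chartLift V r b (inf_le_right : (V a).1 ⊓ (V b).1 ≤ (V b).1))
      (hV : ⨆ a, (V a).1 = ⊤) (hc : ∀ a b, (V a).1 ⊓ (V b).1 = X₀.X.left.basicOpen (c a b))
      (hr : ∀ a, Function.Surjective (r a)) (hkr : ∀ a, RingHom.ker (r a) = J.map (algebraMap A (P a)))
      (hψ : ∀ a b x, reduction (r b) (res (inf_le_right : (V a).1 ⊓ (V b).1 ≤ (V b).1))
          (halg_of_structureMorphism X₀.X.hom _ _ _) (ψ a b x) =
        reduction (r a) (res (inf_le_left : (V a).1 ⊓ (V b).1 ≤ (V a).1)) (halg_of_structureMorphism X₀.X.hom _ _ _) x)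
      [∀ W : (closedFibre hJ X₀).X.left.Opens, Algebra A Γ((closedFibre hJ X₀).X.left, W)]
      (π : (W : X₀.X.left.Opens) → Γ(X₀.X.left, W) →ₐ[A]
        Γ((closedFibre hJ X₀).X.left, (closedFibreι hJ X₀) ⁻¹ᵁ W))
      (hπ : ∀ (a : Fin n) (W : X₀.X.left.Opens), W ≤ (V a).1 → (∃ q : Γ(X₀.X.left, (V a).1), W = X₀.X.left.basicOpen q) →
        Function.Surjective (π W) ∧ RingHom.ker (π W) = (IsLocalRing.maximalIdeal A).map (algebraMap A Γ(X₀.X.left, W)))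
      (δ : (a b d : Fin n) → Derivation A
        Γ((closedFibre hJ X₀).X.left, (closedFibreι hJ X₀) ⁻¹ᵁ ((V a).1 ⊓ (V b).1 ⊓ (V d).1))
        (Γ((closedFibre hJ X₀).X.left, (closedFibreι hJ X₀) ⁻¹ᵁ ((V a).1 ⊓ (V b).1 ⊓ (V d).1)) ⊗[A] ↥J))
      (hδ : ∀ a b d, readingAut (halg_of_structureMorphism X₀.X.hom) (LiftedLaw.isNilpotent_of_ne_top hJ) V r hr hkr
          (IsLocalRing.maximalIdeal A) π hπ hmJ (IsLocalRing.le_maximalIdeal hJ) a (inf_le_left.trans inf_le_left)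
          ⟨_, inf₃_eq_basicOpen₁ V c hc a b d⟩ (δ a b d) =
        disc (halg_of_structureMorphism X₀.X.hom) (LiftedLaw.isNilpotent_of_ne_top hJ) V c hc r hr hkr ψ hψ a b d)
      (halgκ : ∀ (W : (closedFibre hJ X₀).X.left.Opens) (a : A), algebraMap A Γ((closedFibre hJ X₀).X.left, W) a =
        (constToPresheaf (closedFibre hJ X₀).X).app (op W) (algebraMap A (IsLocalRing.ResidueField A) a))
      (hiV : ∀ a, IsAffineOpen ((closedFibreι hJ X₀) ⁻¹ᵁ (V a).1))
      (hπnat : ∀ ⦃W W' : X₀.X.left.Opens⦄ (h : W' ≤ W) (x : Γ(X₀.X.left, W)),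
        (closedFibre hJ X₀).X.left.presheaf.map
          (homOfLE ((closedFibreι hJ X₀).preimage_mono h)).op (π W x) = π W' (res h x))
      (o : CechMC2 (closedFibre hJ X₀).X.hom (tangentSheaf (closedFibre hJ X₀).X) (fun a => (closedFibreι hJ X₀) ⁻¹ᵁ (V a).1))
      (ho : ∀ (a b d : Fin n) (x : Γ((closedFibre hJ X₀).X.left, (closedFibreι hJ X₀) ⁻¹ᵁ (V a).1 ⊓ (closedFibreι hJ X₀) ⁻¹ᵁ (V b).1 ⊓ (closedFibreι hJ X₀) ⁻¹ᵁ (V d).1)),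
        δ a b d x = (show Γ((closedFibre hJ X₀).X.left, (closedFibreι hJ X₀) ⁻¹ᵁ (V a).1 ⊓ (closedFibreι hJ X₀) ⁻¹ᵁ (V b).1 ⊓ (closedFibreι hJ X₀) ⁻¹ᵁ (V d).1) from
          appLE (o a b d) (𝟙 _) (dSection (closedFibre hJ X₀).X _ x)) ⊗ₜ φ.symm 1)
      (ho₂ : o ∈ cechMZ2 (closedFibre hJ X₀).X.hom (tangentSheaf (closedFibre hJ X₀).X) (fun a => (closedFibreι hJ X₀) ⁻¹ᵁ (V a).1))
      (n' : ℕ) (V' : Fin n' → X₀.X.left.affineOpens) (c' : (a b : Fin n') → Γ(X₀.X.left, (V' a).1))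
      (P' : Fin n' → Type) [∀ a, CommRing (P' a)] [∀ a, Algebra A (P' a)] [∀ a, Algebra.IsStandardSmooth A (P' a)]
      [∀ a, Module.Flat A (P' a)]
      (r' : (a : Fin n') → P' a →ₐ[A] Γ(X₀.X.left, (V' a).1))
      (ψ' : (a b : Fin n') → chartLift V' r' a (inf_le_left : (V' a).1 ⊓ (V' b).1 ≤ (V' a).1) ≃ₐ[A]
        chartLift V' r' b (inf_le_right : (V' a).1 ⊓ (V' b).1 ≤ (V' b).1))
      (hV' : ⨆ a, (V' a).1 = ⊤) (hc' : ∀ a b, (V' a).1 ⊓ (V' b).1 = X₀.X.left.basicOpen (c' a b))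
      (hr' : ∀ a, Function.Surjective (r' a)) (hkr' : ∀ a, RingHom.ker (r' a) = J.map (algebraMap A (P' a)))
      (hψ' : ∀ a b x, reduction (r' b) (res (inf_le_right : (V' a).1 ⊓ (V' b).1 ≤ (V' b).1))
          (halg_of_structureMorphism X₀.X.hom _ _ _) (ψ' a b x) =
        reduction (r' a) (res (inf_le_left : (V' a).1 ⊓ (V' b).1 ≤ (V' a).1)) (halg_of_structureMorphism X₀.X.hom _ _ _) x)
      (hπ' : ∀ (a : Fin n') (W : X₀.X.left.Opens), W ≤ (V' a).1 → (∃ q : Γ(X₀.X.left, (V' a).1), W = X₀.X.left.basicOpen q) →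
        Function.Surjective (π W) ∧ RingHom.ker (π W) = (IsLocalRing.maximalIdeal A).map (algebraMap A Γ(X₀.X.left, W)))
      (δ' : (a b d : Fin n') → Derivation A
        Γ((closedFibre hJ X₀).X.left, (closedFibreι hJ X₀) ⁻¹ᵁ ((V' a).1 ⊓ (V' b).1 ⊓ (V' d).1))
        (Γ((closedFibre hJ X₀).X.left, (closedFibreι hJ X₀) ⁻¹ᵁ ((V' a).1 ⊓ (V' b).1 ⊓ (V' d).1)) ⊗[A] ↥J))
      (hδ' : ∀ a b d, readingAut (halg_of_structureMorphism X₀.X.hom) (LiftedLaw.isNilpotent_of_ne_top hJ) V' r' hr' hkr'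
          (IsLocalRing.maximalIdeal A) π hπ' hmJ (IsLocalRing.le_maximalIdeal hJ) a (inf_le_left.trans inf_le_left)
          ⟨_, inf₃_eq_basicOpen₁ V' c' hc' a b d⟩ (δ' a b d) =
        disc (halg_of_structureMorphism X₀.X.hom) (LiftedLaw.isNilpotent_of_ne_top hJ) V' c' hc' r' hr' hkr' ψ' hψ' a b d)
      (hiV' : ∀ a, IsAffineOpen ((closedFibreι hJ X₀) ⁻¹ᵁ (V' a).1))
      (o' : CechMC2 (closedFibre hJ X₀).X.hom (tangentSheaf (closedFibre hJ X₀).X) (fun a => (closedFibreι hJ X₀) ⁻¹ᵁ (V' a).1))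
      (ho' : ∀ (a b d : Fin n') (x : Γ((closedFibre hJ X₀).X.left, (closedFibreι hJ X₀) ⁻¹ᵁ (V' a).1 ⊓ (closedFibreι hJ X₀) ⁻¹ᵁ (V' b).1 ⊓ (closedFibreι hJ X₀) ⁻¹ᵁ (V' d).1)),
        δ' a b d x = (show Γ((closedFibre hJ X₀).X.left, (closedFibreι hJ X₀) ⁻¹ᵁ (V' a).1 ⊓ (closedFibreι hJ X₀) ⁻¹ᵁ (V' b).1 ⊓ (closedFibreι hJ X₀) ⁻¹ᵁ (V' d).1) from
          appLE (o' a b d) (𝟙 _) (dSection (closedFibre hJ X₀).X _ x)) ⊗ₜ φ.symm 1)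
      (ho₂' : o' ∈ cechMZ2 (closedFibre hJ X₀).X.hom (tangentSheaf (closedFibre hJ X₀).X) (fun a => (closedFibreι hJ X₀) ⁻¹ᵁ (V' a).1)),
      ∃ (m : ℕ) (W : Fin m → X₀.X.left.affineOpens) (τ : Fin m → Fin n) (τ' : Fin m → Fin n')
        (hτ : ∀ j, (W j).1 ≤ (V (τ j)).1) (hτ' : ∀ j, (W j).1 ≤ (V' (τ' j)).1),
        (⨆ j, (W j).1 = ⊤) ∧ (∀ j, ∃ q : Γ(X₀.X.left, (V (τ j)).1), (W j).1 = X₀.X.left.basicOpen q) ∧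
        (∀ j, ∃ q : Γ(X₀.X.left, (V' (τ' j)).1), (W j).1 = X₀.X.left.basicOpen q) ∧
        (∀ j, IsAffineOpen ((closedFibreι hJ X₀) ⁻¹ᵁ (W j).1)) ∧
        CechMH2.mk (closedFibre hJ X₀).X.hom (tangentSheaf (closedFibre hJ X₀).X) (fun j => (closedFibreι hJ X₀) ⁻¹ᵁ (W j).1)
            ⟨cechMRefineC2 (closedFibre hJ X₀).X.hom (tangentSheaf (closedFibre hJ X₀).X) (fun a => (closedFibreι hJ X₀) ⁻¹ᵁ (V' a).1)
                (fun j => (closedFibreι hJ X₀) ⁻¹ᵁ (W j).1) τ' (fun j => (closedFibreι hJ X₀).preimage_mono (hτ' j)) o',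
              refineMC2_mem_cechMZ2 (closedFibre hJ X₀).X.hom (tangentSheaf (closedFibre hJ X₀).X)
                (fun a => (closedFibreι hJ X₀) ⁻¹ᵁ (V' a).1) (fun j => (closedFibreι hJ X₀) ⁻¹ᵁ (W j).1) τ' _ ho₂'⟩ =
          CechMH2.mk (closedFibre hJ X₀).X.hom (tangentSheaf (closedFibre hJ X₀).X) (fun j => (closedFibreι hJ X₀) ⁻¹ᵁ (W j).1)
            ⟨cechMRefineC2 (closedFibre hJ X₀).X.hom (tangentSheaf (closedFibre hJ X₀).X) (fun a => (closedFibreι hJ X₀) ⁻¹ᵁ (V a).1)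
                (fun j => (closedFibreι hJ X₀) ⁻¹ᵁ (W j).1) τ (fun j => (closedFibreι hJ X₀).preimage_mono (hτ j)) o,
              refineMC2_mem_cechMZ2 (closedFibre hJ X₀).X.hom (tangentSheaf (closedFibre hJ X₀).X)
                (fun a => (closedFibreι hJ X₀) ⁻¹ᵁ (V a).1) (fun j => (closedFibreι hJ X₀) ⁻¹ᵁ (W j).1) τ _ ho₂⟩ := by
  -- the section rings of `X₀` as `A`-algebras through `X₀ → Spec (A⧸J) → Spec A` (the statement's `letI`, re-installed as an instance)
  letI instΓ₀ : ∀ W : X₀.X.left.Opens, Algebra A Γ(X₀.X.left, W) := fun W =>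
    (((Scheme.ΓSpecIso (.of (A ⧸ J))).inv ≫ X₀.X.hom.appLE ⊤ W le_top).hom.comp (Ideal.Quotient.mk J)).toAlgebra
  intro n V c P _ _ _ _ r ψ hV hc hr hkr hψ instκ π hπ δ hδ halgκ hiV hπnat o ho ho₂
    -- … and the letters of the SECOND datum:
    n' V' c' P' _ _ _ _ r' ψ' hV' hc' hr' hkr' hψ' hπ' δ' hδ' hiV' o' ho' ho₂'
  -- names
  have halg₀ := halg_of_structureMorphism (A' := A) X₀.X.hom
  have hJnil : IsNilpotent J := LiftedLaw.isNilpotent_of_ne_top hJ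
  have hκ : Function.Surjective (algebraMap A (IsLocalRing.ResidueField A)) := IsLocalRing.residue_surjective
  haveI : Smooth X₀.X.hom := X₀.isSmooth
  haveI : CompactSpace X₀.X.left := by
    haveI := X₀.isProper
    exact QuasiCompact.compactSpace_of_compactSpace X₀.X.hom
  /- (1) THE COMMON DOUBLY-PRINCIPAL REFINEMENT `W` of `V` and `V'` (★ `Morphisms/PrincipalAffineCoverBasicOpenRefinement`), re-indexed by `Fin m`. -/
  obtain ⟨T, _, Wt, cWt, τt, τt', at₁, at₂, hWt, hcWt, hWa, hWa'⟩ :=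
    Morphisms.exists_finite_principal_affine_cover_basicOpen_refinement₂ V c hc hV V' hV'
  obtain ⟨m, ⟨e⟩⟩ := Finite.exists_equiv_fin T
  obtain ⟨W, cW, τ, τ', hW, hcW, hτ, pτ, hτ', pτ'⟩ : ∃ (W : Fin m → X₀.X.left.affineOpens) (cW : (j k : Fin m) → Γ(X₀.X.left, (W j).1))
      (τ : Fin m → Fin n) (τ' : Fin m → Fin n'),
      (⨆ j, (W j).1 = ⊤) ∧ (∀ j k, (W j).1 ⊓ (W k).1 = X₀.X.left.basicOpen (cW j k)) ∧
      (∀ j, (W j).1 ≤ (V (τ j)).1) ∧ (∀ j, ∃ q : Γ(X₀.X.left, (V (τ j)).1), (W j).1 = X₀.X.left.basicOpen q) ∧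
      (∀ j, (W j).1 ≤ (V' (τ' j)).1) ∧ (∀ j, ∃ q : Γ(X₀.X.left, (V' (τ' j)).1), (W j).1 = X₀.X.left.basicOpen q) := by
    refine ⟨fun j => Wt (e.symm j), fun j k => cWt (e.symm j) (e.symm k), fun j => τt (e.symm j), fun j => τt' (e.symm j),
      ?_, fun j k => hcWt _ _, fun j => ?_, fun j => ⟨at₁ _, hWa _⟩, fun j => ?_, fun j => ⟨at₂ _, hWa' _⟩⟩
    · rw [← hWt]
      exact e.symm.iSup_comp (g := fun t => (Wt t).1)
    · rw [hWa]; exact X₀.X.left.basicOpen_le _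
    · rw [hWa']; exact X₀.X.left.basicOpen_le _
  /- (2) THE TWO DATA RESTRICTED TO `W` (★ (vii-e) `SmoothLiftAtlasRefinement{,Class}Quot`): flat ∕ formally smooth restricted charts, and
  the restricted face readings `δ₁`, `δ₂` represented by the refined cochains `ρ_τ o`, `ρ_τ' o'` (`exists_faceReadings_refine_rep`, which builds
  the κ-side restriction maps from ★ (vii) `exists_algHom_res` + `hπnat`). -/
  haveI : ∀ j, Module.Flat A (chartLift V r (τ j) (hτ j)) := fun j => Deformation.CanonicalLiftQuot.flat _ _
  haveI : ∀ j, Module.Flat A (chartLift V' r' (τ' j) (hτ' j)) := fun j => Deformation.CanonicalLiftQuot.flat _ _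
  haveI : ∀ j, Algebra.FormallySmooth A (chartLift V' r' (τ' j) (hτ' j)) := fun j => Deformation.CanonicalLiftQuot.formallySmooth _ _
  obtain ⟨δ₁, hδ₁, ho₁⟩ := Deformation.AtlasRefinementQuot.exists_faceReadings_refine_rep (hκ := hκ) (halg := halgκ) (J := J) (φ := φ)
    (i := closedFibreι hJ X₀) (V := V) (c := c) (hc := hc) (hiV := hiV) (V' := W) (τ := τ) (hτ := hτ) (pτ := pτ) (c' := cW) (hc' := hcW)
    (halg₀ := halg₀) (hJ := hJnil) (r := r) (hr := hr) (hkr := hkr) (ψ := ψ) (hψ := hψ) (𝔪 := IsLocalRing.maximalIdeal A) (h𝔪J := hmJ)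
    (hJ𝔪 := IsLocalRing.le_maximalIdeal hJ) (π := π) (hπ := hπ) (hπnat := hπnat) (δ := δ) (hδ := hδ) (ho := ho)
  obtain ⟨δ₂, hδ₂, ho₂r⟩ := Deformation.AtlasRefinementQuot.exists_faceReadings_refine_rep (hκ := hκ) (halg := halgκ) (J := J) (φ := φ)
    (i := closedFibreι hJ X₀) (V := V') (c := c') (hc := hc') (hiV := hiV') (V' := W) (τ := τ') (hτ := hτ') (pτ := pτ') (c' := cW)
    (hc' := hcW) (halg₀ := halg₀) (hJ := hJnil) (r := r') (hr := hr') (hkr := hkr') (ψ := ψ') (hψ := hψ') (𝔪 := IsLocalRing.maximalIdeal A)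
    (h𝔪J := hmJ) (hJ𝔪 := IsLocalRing.le_maximalIdeal hJ) (π := π) (hπ := hπ') (hπnat := hπnat) (δ := δ') (hδ := hδ') (ho := ho')
  /- (3) ON `W` THE CLASS DOES NOT DEPEND ON THE CHARTS ∕ GLUINGS ∕ READINGS (★ (vii-f) `SmoothLiftAtlasChartChangeClassQuot`):
  `[ρ_τ' o'] = [ρ_τ o]`. -/
  have hiW : ∀ j, IsAffineOpen ((closedFibreι hJ X₀) ⁻¹ᵁ (W j).1) := fun j =>
    Deformation.AtlasRefinementQuot.isAffineOpen_preimage_refine (i := closedFibreι hJ X₀) (V := V) (hiV := hiV) (V' := W) (τ := τ)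
      (pτ := pτ) j
  have key := Deformation.AtlasChartChangeQuot.cechMH2_mk_eq_of_chartChange (J := J) (halg₀ := halg₀) (hJ := hJnil) (V := W) (c := cW)
    (hc := hcW) (r := Deformation.AtlasRefinementQuot.refineRed halg₀ V r W τ hτ)
    (hr := Deformation.AtlasRefinementQuot.refineRed_surjective halg₀ hJnil V r hr hkr W τ hτ pτ)
    (hkr := Deformation.AtlasRefinementQuot.ker_refineRed halg₀ hJnil V r hr hkr W τ hτ pτ)
    (r' := Deformation.AtlasRefinementQuot.refineRed halg₀ V' r' W τ' hτ')
    (hr' := Deformation.AtlasRefinementQuot.refineRed_surjective halg₀ hJnil V' r' hr' hkr' W τ' hτ' pτ')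
    (hkr' := Deformation.AtlasRefinementQuot.ker_refineRed halg₀ hJnil V' r' hr' hkr' W τ' hτ' pτ')
    (hκ := hκ) (halg := halgκ) (φ := φ) (i := closedFibreι hJ X₀) (hiV := hiW) (𝔪 := IsLocalRing.maximalIdeal A) (h𝔪J := hmJ)
    (hJ𝔪 := IsLocalRing.le_maximalIdeal hJ) (π := π)
    (hπ := Deformation.AtlasRefinementQuot.hπ_refine V W τ hτ pτ (IsLocalRing.maximalIdeal A) π hπ) hπnat
    (Deformation.AtlasRefinementQuot.refineGluing halg₀ hJnil V r hr hkr ψ hψ W τ hτ pτ cW hcW)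
    (Deformation.AtlasRefinementQuot.reduction_refineGluing halg₀ hJnil V r hr hkr ψ hψ W τ hτ pτ cW hcW)
    (Deformation.AtlasRefinementQuot.refineGluing halg₀ hJnil V' r' hr' hkr' ψ' hψ' W τ' hτ' pτ' cW hcW)
    (Deformation.AtlasRefinementQuot.reduction_refineGluing halg₀ hJnil V' r' hr' hkr' ψ' hψ' W τ' hτ' pτ' cW hcW)
    δ₁ δ₂ hδ₁ hδ₂ ho₁ ho₂r
    (refineMC2_mem_cechMZ2 _ _ _ _ τ (fun j => (closedFibreι hJ X₀).preimage_mono (hτ j)) ho₂)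
    (refineMC2_mem_cechMZ2 _ _ _ _ τ' (fun j => (closedFibreι hJ X₀).preimage_mono (hτ' j)) ho₂')
  /- (4) EXPORT: the refinement, its principal ∕ affine-trace witnesses, and the equality of the refined classes. -/
  exact ⟨m, W, τ, τ', hτ, hτ', hW, pτ, pτ', hiW, key⟩

end Literature.AlgebraicGeometry.AbelianSchemes.AbelianSchemeOver

end
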